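import Summits.CriticalPhenomena.SAWScalingLimit.Theses.SAWPhaseRetrieval
import Literature.Probability.LatticeModels.TriangularLatticeProofs
import Literature.Probability.Percolation.SmirnovSeparatingData

/-!
# Retrieval stability, disc case — algebraic toolkit

Helper inequalities for the proof of `SAWPhaseRetrieval.RetrievalStabilityDisc`
(stmt-CriticalPhenomena-11413): near-positivity of complex numbers with phase close to `1`,
the "three reals" lemma behind local isotropy and the comparison of the sides of lattice
equilateral triangles (`|x + (ζ-1) y - ζ z| ≤ ε (x+y+z)` forces `x ≈ y ≈ z`), bounds on
`Im (c · conj U · V)` for near-positive `U, V`, and the variance-to-`L¹` step.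
All statements are elementary real/complex algebra; `ζ = triZeta = e^{iπ/3}`.
-/

namespace Summit.CriticalPhenomena.SAWScalingLimit.Theorems

open Literature.Probability.LatticeModels Literature.Probability.Percolation Complex

/-! ### The sixth root of unity -/

/-- `ζ - 1 = ζ²` has norm `1`. [folklore] -/
theorem rsd_norm_triZeta_sub_one : ‖triZeta - 1‖ = 1 := by
  rw [← triZeta_sq, norm_pow, norm_triZeta, one_pow]

/-- `Im (ζ - 1) = √3/2`. [folklore] -/
theorem rsd_im_triZeta_sub_one : (triZeta - 1).im = Real.sqrt 3 / 2 := by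
  simp

/-- `1 - 2ζ = -i√3 ≠ 0`. [folklore] -/
theorem rsd_one_sub_two_mul_triZeta_ne_zero : (1 : ℂ) - 2 * triZeta ≠ 0 := by
  intro h
  have him := congrArg Complex.im h
  simp at him

/-! ### Near-positive complex numbers -/

/-- If the unit vector of `G ≠ 0` is within `ε` of `1`, then `G` is within `ε‖G‖` of the positive
real `‖G‖`. [folklore] -/
theorem rsd_norm_sub_norm_le {G : ℂ} {ε : ℝ} (hG : G ≠ 0)
    (h : ‖G / ((‖G‖ : ℝ) : ℂ) - 1‖ ≤ ε) : ‖G - ((‖G‖ : ℝ) : ℂ)‖ ≤ ε * ‖G‖ := by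
  have hn : (0 : ℝ) < ‖G‖ := norm_pos_iff.2 hG
  have hne : ((‖G‖ : ℝ) : ℂ) ≠ 0 := by exact_mod_cast hn.ne'
  have key : G - ((‖G‖ : ℝ) : ℂ) = (G / ((‖G‖ : ℝ) : ℂ) - 1) * ((‖G‖ : ℝ) : ℂ) := by
    field_simp
  rw [key, norm_mul, Complex.norm_real, Real.norm_eq_abs, abs_of_pos hn]
  exact mul_le_mul_of_nonneg_right h hn.le

/-- Sums of near-positive numbers are near-positive: if every `g i` is within `ε‖g i‖` of `‖g i‖`
then `∑ g` is within `ε ∑ ‖g i‖` of `∑ ‖g i‖`. [folklore] -/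
theorem rsd_norm_sum_sub_le {ι : Type*} (s : Finset ι) (g : ι → ℂ) {ε : ℝ}
    (h : ∀ i ∈ s, ‖g i - ((‖g i‖ : ℝ) : ℂ)‖ ≤ ε * ‖g i‖) :
    ‖(∑ i ∈ s, g i) - ((∑ i ∈ s, ‖g i‖ : ℝ) : ℂ)‖ ≤ ε * ∑ i ∈ s, ‖g i‖ := by
  have : (∑ i ∈ s, g i) - ((∑ i ∈ s, ‖g i‖ : ℝ) : ℂ) = ∑ i ∈ s, (g i - ((‖g i‖ : ℝ) : ℂ)) := by
    rw [Finset.sum_sub_distrib]; push_cast; rfl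
  rw [this, Finset.mul_sum]
  exact (norm_sum_le _ _).trans (Finset.sum_le_sum h)

/-! ### The three-reals lemma -/

/-- `|x + (ζ-1) y - ζ z|² = x² + y² + z² - xy - yz - zx` for real `x, y, z`. [folklore] -/
theorem rsd_normSq_three (x y z : ℝ) :
    Complex.normSq ((x : ℂ) + (triZeta - 1) * y - triZeta * z) =
      x ^ 2 + y ^ 2 + z ^ 2 - x * y - y * z - z * x := by
  have h3 : Real.sqrt 3 * Real.sqrt 3 = 3 := Real.mul_self_sqrt (by norm_num)
  rw [Complex.normSq_apply]
  simp only [add_re, sub_re, mul_re, ofReal_re, ofReal_im, triZeta_re, triZeta_im, one_re,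
    one_im, mul_zero, sub_zero, add_im, sub_im, mul_im, zero_add]
  nlinarith [h3]

/-- **Three reals.** If `X + (ζ-1) Y - ζ Z = 0` and `X, Y, Z` are within relative distance `ε` of
the non-negative reals `x, y, z`, then `(x-y)² + (y-z)² + (z-x)² ≤ 2 ε² (x+y+z)²`. [folklore] -/
theorem rsd_three_reals {X Y Z : ℂ} {x y z ε : ℝ}
    (hrel : X + (triZeta - 1) * Y - triZeta * Z = 0)
    (hX : ‖X - x‖ ≤ ε * x) (hY : ‖Y - y‖ ≤ ε * y) (hZ : ‖Z - z‖ ≤ ε * z) :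
    (x - y) ^ 2 + (y - z) ^ 2 + (z - x) ^ 2 ≤ 2 * ε ^ 2 * (x + y + z) ^ 2 := by
  have key : ((x : ℂ) + (triZeta - 1) * y - triZeta * z) =
      -((X - x) + (triZeta - 1) * (Y - y) - triZeta * (Z - z)) := by
    linear_combination hrel
  have hnorm : ‖(x : ℂ) + (triZeta - 1) * y - triZeta * z‖ ≤ ε * (x + y + z) := by
    rw [key, norm_neg]
    calc ‖(X - x) + (triZeta - 1) * (Y - y) - triZeta * (Z - z)‖
        ≤ ‖(X - x) + (triZeta - 1) * (Y - y)‖ + ‖triZeta * (Z - z)‖ := norm_sub_le _ _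
      _ ≤ ‖X - x‖ + ‖(triZeta - 1) * (Y - y)‖ + ‖triZeta * (Z - z)‖ := by
          gcongr; exact norm_add_le _ _
      _ = ‖X - x‖ + ‖Y - y‖ + ‖Z - z‖ := by
          rw [norm_mul, norm_mul, rsd_norm_triZeta_sub_one, norm_triZeta, one_mul, one_mul]
      _ ≤ ε * x + ε * y + ε * z := by gcongr
      _ = ε * (x + y + z) := by ring
  have hsq : ‖(x : ℂ) + (triZeta - 1) * y - triZeta * z‖ ^ 2 ≤ (ε * (x + y + z)) ^ 2 :=
    pow_le_pow_left₀ (norm_nonneg _) hnorm 2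
  rw [← Complex.normSq_eq_norm_sq, rsd_normSq_three] at hsq
  nlinarith [hsq]

/-- Pairwise form of the three-reals lemma: each pair differs by at most `(3/2) ε (x+y+z)`.
[folklore] -/
theorem rsd_three_reals_pairwise {x y z ε : ℝ} (hx : 0 ≤ x) (hy : 0 ≤ y) (hz : 0 ≤ z)
    (hε : 0 ≤ ε) (h : (x - y) ^ 2 + (y - z) ^ 2 + (z - x) ^ 2 ≤ 2 * ε ^ 2 * (x + y + z) ^ 2) :
    |x - y| ≤ 3 / 2 * ε * (x + y + z) ∧ |y - z| ≤ 3 / 2 * ε * (x + y + z) ∧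
      |z - x| ≤ 3 / 2 * ε * (x + y + z) := by
  have hc : 0 ≤ 3 / 2 * ε * (x + y + z) := by positivity
  refine ⟨abs_le_of_sq_le_sq' ?_ hc |> fun h => abs_le.2 h,
    abs_le_of_sq_le_sq' ?_ hc |> fun h => abs_le.2 h,
    abs_le_of_sq_le_sq' ?_ hc |> fun h => abs_le.2 h⟩
  · nlinarith [sq_nonneg (y - z), sq_nonneg (z - x)]
  · nlinarith [sq_nonneg (x - y), sq_nonneg (z - x)]
  · nlinarith [sq_nonneg (x - y), sq_nonneg (y - z)]

/-- Relative form: with `ε ≤ 1/10`, the other two reals are within `7 ε x` of the reference `x`.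
[folklore] -/
theorem rsd_three_reals_rel {x y z ε : ℝ} (hx : 0 ≤ x) (hy : 0 ≤ y) (hz : 0 ≤ z)
    (hε : 0 ≤ ε) (hε1 : ε ≤ 1 / 10)
    (hxy : |x - y| ≤ 3 / 2 * ε * (x + y + z)) (hzx : |z - x| ≤ 3 / 2 * ε * (x + y + z)) :
    |y - x| ≤ 7 * ε * x ∧ |z - x| ≤ 7 * ε * x := by
  have h1 := (abs_le.1 hxy).1
  have h2 := (abs_le.1 hzx).2
  have hS : x + y + z ≤ 30 / 7 * x := by nlinarith
  have hb : 3 / 2 * ε * (x + y + z) ≤ 7 * ε * x := by nlinarith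
  exact ⟨by rw [abs_sub_comm]; exact hxy.trans hb, hzx.trans hb⟩

/-! ### Imaginary parts of products of near-positive numbers -/

/-- For `‖c‖ ≤ 1` and `U, V` within relative `ε ≤ 1` of the non-negative reals `u, v`:
`|Im (c · conj U · V) - u v Im c| ≤ 3 ε u v`. [folklore] -/
theorem rsd_im_mul_conj_mul_sub_le {c U V : ℂ} {u v ε : ℝ} (hc : ‖c‖ ≤ 1) (hu : 0 ≤ u)
    (hv : 0 ≤ v) (hε : 0 ≤ ε) (hε1 : ε ≤ 1) (hU : ‖U - u‖ ≤ ε * u) (hV : ‖V - v‖ ≤ ε * v) :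
    |(c * (starRingEnd ℂ) U * V).im - u * v * c.im| ≤ 3 * ε * (u * v) := by
  set α := U - u with hα
  set β := V - v with hβ
  have hUe : U = u + α := by rw [hα]; ring
  have hVe : V = v + β := by rw [hβ]; ring
  have hD : c * (starRingEnd ℂ) U * V =
      c * u * v + c * ((starRingEnd ℂ) α * v + u * β + (starRingEnd ℂ) α * β) := by
    rw [hUe, hVe]
    simp only [map_add, Complex.conj_ofReal]
    ring
  have h0 : (c * (u : ℂ) * (v : ℂ)).im = u * v * c.im := by
    simp only [mul_im, ofReal_re, ofReal_im, mul_zero, mul_re, sub_zero]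
    ring
  have him : (c * (starRingEnd ℂ) U * V).im - u * v * c.im =
      (c * ((starRingEnd ℂ) α * v + u * β + (starRingEnd ℂ) α * β)).im := by
    rw [hD, add_im, h0]
    ring
  rw [him]
  have hε2 : ε * u * (ε * v) ≤ ε * u * v := by
    calc ε * u * (ε * v) = ε * (ε * u * v) := by ring
      _ ≤ 1 * (ε * u * v) := mul_le_mul_of_nonneg_right hε1 (by positivity)
      _ = ε * u * v := one_mul _
  calc |(c * ((starRingEnd ℂ) α * ↑v + ↑u * β + (starRingEnd ℂ) α * β)).im|
      ≤ ‖c * ((starRingEnd ℂ) α * ↑v + ↑u * β + (starRingEnd ℂ) α * β)‖ := abs_im_le_norm _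
    _ = ‖c‖ * ‖(starRingEnd ℂ) α * ↑v + ↑u * β + (starRingEnd ℂ) α * β‖ := norm_mul _ _
    _ ≤ 1 * (‖(starRingEnd ℂ) α * ↑v‖ + ‖(u : ℂ) * β‖ + ‖(starRingEnd ℂ) α * β‖) := by
        gcongr
        exact norm_add₃_le
    _ = ‖α‖ * v + u * ‖β‖ + ‖α‖ * ‖β‖ := by
        rw [one_mul, norm_mul, norm_mul, norm_mul, Complex.norm_conj, Complex.norm_real,
          Complex.norm_real, Real.norm_of_nonneg hv, Real.norm_of_nonneg hu]
    _ ≤ ε * u * v + u * (ε * v) + ε * u * (ε * v) := by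
        gcongr
    _ ≤ 3 * ε * (u * v) := by nlinarith [mul_nonneg hu hv, hε2]

/-- Lower bound for the signed area of a near-equilateral image triangle:
`Im (conj U · (ζ V)) ≥ u v (√3/2 - 3ε)`. [folklore] -/
theorem rsd_im_conj_mul_zeta_mul_ge {U V : ℂ} {u v ε : ℝ} (hu : 0 ≤ u) (hv : 0 ≤ v)
    (hε : 0 ≤ ε) (hε1 : ε ≤ 1) (hU : ‖U - u‖ ≤ ε * u) (hV : ‖V - v‖ ≤ ε * v) :
    u * v * (Real.sqrt 3 / 2 - 3 * ε) ≤ ((starRingEnd ℂ) U * (triZeta * V)).im := by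
  have h := rsd_im_mul_conj_mul_sub_le (c := triZeta) (le_of_eq norm_triZeta) hu hv hε hε1
    hU hV
  have e : triZeta * (starRingEnd ℂ) U * V = (starRingEnd ℂ) U * (triZeta * V) := by ring
  rw [e, triZeta_im] at h
  have := (abs_le.1 h).1
  nlinarith

/-! ### From second and first moments to the `L¹` deviation -/

/-- If `∑ f² ≤ A`, `B ≤ ∑ f` and `m ≥ 0` on a finite set of `N` elements, then
`(∑ |f - m|)² ≤ N (A - 2 m B + N m²)` (expand the variance and apply Cauchy–Schwarz).
[folklore] -/
theorem rsd_l1_sq_le {ι : Type*} (s : Finset ι) (f : ι → ℝ) {A B m : ℝ} (hm : 0 ≤ m)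
    (h2 : ∑ i ∈ s, f i ^ 2 ≤ A) (h1 : B ≤ ∑ i ∈ s, f i) :
    (∑ i ∈ s, |f i - m|) ^ 2 ≤ s.card * (A - 2 * m * B + s.card * m ^ 2) := by
  have hcs := Finset.sum_mul_sq_le_sq_mul_sq s (fun i => |f i - m|) (fun _ => (1 : ℝ))
  simp only [mul_one, one_pow, Finset.sum_const, nsmul_eq_mul, sq_abs] at hcs
  have hvar : ∑ i ∈ s, (f i - m) ^ 2 = ∑ i ∈ s, f i ^ 2 - 2 * m * ∑ i ∈ s, f i + s.card * m ^ 2 := by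
    have : ∀ i ∈ s, (f i - m) ^ 2 = f i ^ 2 - 2 * m * f i + m ^ 2 := fun i _ => by ring
    rw [Finset.sum_congr rfl this, Finset.sum_add_distrib, Finset.sum_sub_distrib,
      Finset.mul_sum, Finset.sum_const, nsmul_eq_mul]
  rw [hvar] at hcs
  have hN : (0 : ℝ) ≤ s.card := Nat.cast_nonneg _
  calc (∑ i ∈ s, |f i - m|) ^ 2
      ≤ (∑ i ∈ s, f i ^ 2 - 2 * m * ∑ i ∈ s, f i + s.card * m ^ 2) * s.card := by
        simpa [mul_comm] using hcs
    _ ≤ (A - 2 * m * B + s.card * m ^ 2) * s.card := by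
        apply mul_le_mul_of_nonneg_right _ hN
        nlinarith
    _ = s.card * (A - 2 * m * B + s.card * m ^ 2) := by ring

end Summit.CriticalPhenomena.SAWScalingLimit.Theorems
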